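import Summits.Ventures.CertifiedQuantumChemistry.Rows.CARNormalOrderSound
import Summits.Ventures.CertifiedQuantumChemistry.Rows.SectorBlockLowerBound
import HarnessLib

/-!
# Ventures/CertifiedQuantumChemistry — Rows/SOSDualCert.lean: certificate data and term lists of the KERNEL REPLAY of an
# SDP dual (sum-of-squares) lower certificate (part 1 of 3: computable definitions; parts 2–3: `SOSDualSemantics`, `SOSDualReplay`)

HONEST FRAMING (verbatim): certified bounds for a stated model Hamiltonian in a stated basis; not a
claim about the real molecule beyond that model.

var-2 (gen 17), zero compute; definitions only (no claim node, no model instance, NO BOUND ASSERTED; instances live in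
`Certificates/`).

A `certsdp-conic/1` certificate of a FORMAT-qcl1 (`qcl1/0.1.1`, profile `sz`) DQG instance consists of integer
lower-triangular factors `L_b` (one per PSD block `b`, `G_b = L_b L_bᵀ / 4^K`) and rational equality multipliers `λ_r`;
by the OPERATOR DICTIONARY of FORMAT-qcl1 §2–§5, `H_F − Σ_b Σ_{XY} G_b[X,Y] O_X† O_Y − Σ_r (λ_r/2)(J_r + J_r†) = β·1 +
Σ_i p_i W_i` with `O_X` the block's family words (§4), `J_r = X_r (N̂_τ − N_τ)` the sector-ideal elements of the equality
rows (§5) and `W_i` ladder words (§3), and the certified bound is `β − Σ|p_i|`. This file holds the computable side: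
* `SOSDual.Block` / `Mult` / `Cert` — the data, all naturals (letters `2·(σ·k + p) + d`, integers `e ↦ (−1)^e ⌊e/2⌋`,
  a multiplier = `(num, den, word X, τ)` for `(λ_r/2)(X (N̂_τ − N_τ) + h.c.)`, `N_0 = a`, `N_1 = b`);
* the term lists (`Terms k = List (word × ℚ)` over the letters `Orb (Fin k)`): `hamTerms F` = the model's OWN integrals
  (`Σ h_pq a†a + Σ (pq|rs)/2 a†a†aa`, zero coefficients dropped), `gramTermsOf K PL` / `gramTermsL` / `gramTerms`
  (`Σ_{XY} (dotZ L_X L_Y / 4^K) · O_X† O_Y`), `multTermsOf` / `multTerms`, `certTerms = ham − gram − mult`,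
  **`sosBound F a b c = E_core + lowerConst (normalize (certTerms F a b c))`** (monolithic form);
* `EncPoly`, `encPoly` / `decPoly` / `decOrb` (polynomials with coded letters, for the block-wise replay whose
  intermediate collected polynomials are produced by `eval%` and re-checked by the kernel) and two instance-search
  shortcuts (`DecidableEq` of terms / polynomials over `Orb (Fin k)`).

References: FORMAT-qcl1 v0.3.0 §2–§7 (HOME `pub-qchem-rdm/FORMAT-qcl1.md`); C. Jansson, D. Chaykin, C. Keil, SIAM J.
Numer. Anal. 46 (2007) 180 (rigorous SDP bounds with a-priori primal bounds); D. A. Mazziotti, Phys. Rev. Lett. 93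
(2004) 213001 (DQG 2-positivity).
-/

namespace Summit.Ventures.CertifiedQuantumChemistry

open Matrix
open Literature.MathematicalPhysics.QuantumLattice Literature.MathematicalPhysics.QuantumChemistry
open CARPoly

namespace SOSDual

/-! ## Certificate data (naturals only) -/

/-- One PSD block: family words (letter codes) and the sign-encoded integer factor rows `L_b` (row `X`, lower
triangular as emitted by `certsdp`). -/
structure Block where
  /-- family words `O_X`, letters coded `2·(σ·k + p) + d` -/
  fam : List (List ℕ)
  /-- factor rows, entries coded `e ↦ (−1)^e ⌊e/2⌋` -/
  rows : List (List ℕ)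

/-- One equality multiplier: coefficient `(−1)^num ⌊num/2⌋ / den`, left word `X`, spin `τ` of the ideal `N̂_τ − N_τ`. -/
structure Mult where
  /-- sign-encoded numerator -/
  num : ℕ
  /-- denominator -/
  den : ℕ
  /-- the word `X` (letter codes) -/
  word : List ℕ
  /-- spin of the number operator (`0` = up / `a`, otherwise down / `b`) -/
  spin : ℕ

/-- A whole certificate: the dyadic exponent `K` (`G_b = L_b L_bᵀ / 4^K`), the blocks, the multipliers. -/
structure Cert where
  /-- dyadic exponent -/
  K : ℕ
  /-- PSD blocks -/
  blocks : List Block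
  /-- equality multipliers -/
  mults : List Mult

/-! ## Decoding (computable) -/

variable {k : ℕ}

/-- Sign decoding `e ↦ (−1)^e ⌊e/2⌋`. -/
def zdec (e : ℕ) : ℤ := if e % 2 = 0 then ((e / 2 : ℕ) : ℤ) else -((e / 2 : ℕ) : ℤ)

/-- Letter decoding: code `2·(σ·k + p) + d` ↦ `(orb p σ, d = 1)` (out-of-range codes are reduced modulo; harmless). -/
def decLetter (k : ℕ) [NeZero k] (e : ℕ) : Orb (Fin k) × Bool :=
  (orb (Fin.ofNat k (e / 2 % k)) (if e / 2 / k % 2 = 0 then 0 else 1), e % 2 == 1)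

/-- Word decoding. -/
def decWord (k : ℕ) [NeZero k] (w : List ℕ) : List (Orb (Fin k) × Bool) := w.map (decLetter k)

/-- The adjoint word: reversed, daggers flipped. -/
def dagger {α : Type*} (w : List (α × Bool)) : List (α × Bool) := w.reverse.map fun l => (l.1, !l.2)

/-- Integer dot product of two rows (truncating to the shorter). -/
def dotZ : List ℤ → List ℤ → ℤ
  | x :: xs, y :: ys => x * y + dotZ xs ys
  | _, _ => 0

/-- Packed-table accessor (instances may store a model's integrals as packed naturals and prove agreement with the
model): slot `i` of width `w` bits of `T`, sign-decoded, over the common denominator `D`. -/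
def packedEntry (T w D i : ℕ) : ℚ := (zdec ((T >>> (w * i)) &&& (2 ^ w - 1)) : ℚ) / D

/-- Sort-key encoding of a letter. -/
def encL (x : Orb (Fin k)) : ℕ := 2 * (ofLex x).1.val + (ofLex x).2.val

/-! ## The term lists (computable) -/

/-- Abbreviation: term lists over the letters of `k` orbitals. -/
abbrev Terms (k : ℕ) := List (List (Orb (Fin k) × Bool) × ℚ)

/-- The list `[0, 1, …, n−1]` of `Fin n` (structural; `List.finRange` goes through `Array`). -/
def finList : (n : ℕ) → List (Fin n)
  | 0 => []
  | n + 1 => (0 : Fin (n + 1)) :: (finList n).map Fin.succ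

/-- Negate all coefficients. -/
def negTerms (T : Terms k) : Terms k := T.map fun wc => (wc.1, -wc.2)

/-- Drop zero coefficients. -/
def dropZero (T : Terms k) : Terms k := T.filter fun wc => wc.2 ≠ 0

/-- One-body terms `Σ_{p q σ} h_pq · a†_{pσ} a_{qσ}` of a model. -/
def oneBodyTerms (F : Model k) : Terms k :=
  (finList k).flatMap fun p => (finList k).flatMap fun q => (finList 2).map fun σ =>
    ([(orb p σ, true), (orb q σ, false)], F.h p q)

/-- Two-body terms `Σ_{p q r s σ τ} ((pq|rs)/2) · a†_{pσ} a†_{rτ} a_{sτ} a_{qσ}` of a model. -/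
def twoBodyTerms (F : Model k) : Terms k :=
  (finList k).flatMap fun p => (finList k).flatMap fun q => (finList k).flatMap fun r =>
    (finList k).flatMap fun s => (finList 2).flatMap fun σ => (finList 2).map fun τ =>
      ([(orb p σ, true), (orb r τ, true), (orb s τ, false), (orb q σ, false)], F.eri p q r s / 2)

/-- All terms of `H_F − E_core·1`, zero coefficients dropped. -/
def hamTerms (F : Model k) : Terms k := dropZero (oneBodyTerms F ++ twoBodyTerms F)

/-- One-body terms from an integral ACCESSOR `H` (an instance may supply a fast packed table proved equal to `F.h`). -/
def oneBodyTermsWith (H : Fin k → Fin k → ℚ) : Terms k :=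
  (finList k).flatMap fun p => (finList k).flatMap fun q => (finList 2).map fun σ =>
    ([(orb p σ, true), (orb q σ, false)], H p q)

/-- Two-body terms from an integral ACCESSOR `V` (an instance may supply a fast packed table proved equal to `F.eri`). -/
def twoBodyTermsWith (V : Fin k → Fin k → Fin k → Fin k → ℚ) : Terms k :=
  (finList k).flatMap fun p => (finList k).flatMap fun q => (finList k).flatMap fun r =>
    (finList k).flatMap fun s => (finList 2).flatMap fun σ => (finList 2).map fun τ =>
      ([(orb p σ, true), (orb r τ, true), (orb s τ, false), (orb q σ, false)], V p q r s / 2)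

/-- All terms of `H − E_core·1` from integral accessors, zero coefficients dropped. -/
def hamTermsWith (H : Fin k → Fin k → ℚ) (V : Fin k → Fin k → Fin k → Fin k → ℚ) : Terms k :=
  dropZero (oneBodyTermsWith H ++ twoBodyTermsWith V)

/-- `hamTerms F` is `hamTermsWith` at the model's own accessors. -/
theorem hamTerms_eq_hamTermsWith (F : Model k) : hamTerms F = hamTermsWith F.h F.eri := rfl

/-- Gram terms of one decoded block: `Σ_{X,Y} (dotZ L_X L_Y / 4^K) · O_X† O_Y` over the zipped (word, row) list. -/
def gramTermsOf (K : ℕ) (PL : List (List (Orb (Fin k) × Bool) × List ℤ)) : Terms k :=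
  PL.flatMap fun a => PL.map fun b => (dagger a.1 ++ b.1, (dotZ a.2 b.2 : ℚ) / 4 ^ K)

/-- Decoded (word, row) list of a block. -/
def Block.decode (k : ℕ) [NeZero k] (B : Block) : List (List (Orb (Fin k) × Bool) × List ℤ) :=
  List.zip (B.fam.map (decWord k)) (B.rows.map fun r => r.map zdec)

/-- Gram terms of a list of blocks. -/
def gramTermsL (k : ℕ) [NeZero k] (K : ℕ) (blocks : List Block) : Terms k :=
  blocks.flatMap fun B => gramTermsOf K (B.decode k)

/-- Gram terms of all blocks of a certificate. -/
def gramTerms (k : ℕ) [NeZero k] (c : Cert) : Terms k := gramTermsL k c.K c.blocks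

/-- The number word `a†_{yτ} a_{yτ}`. -/
def numWord (y : Fin k) (τ : Fin 2) : List (Orb (Fin k) × Bool) := [(orb y τ, true), (orb y τ, false)]

/-- Terms of `c · (X (N̂_τ − n) + (N̂_τ − n) X†)` for a decoded multiplier. -/
def multTermsOf (q : ℚ) (X : List (Orb (Fin k) × Bool)) (τ : Fin 2) (n : ℕ) : Terms k :=
  ((finList k).flatMap fun y => [(X ++ numWord y τ, q), (numWord y τ ++ dagger X, q)]) ++
    [(X, -(q * n)), (dagger X, -(q * n))]

/-- The rational coefficient of a multiplier. -/
def Mult.coeff (M : Mult) : ℚ := (zdec M.num : ℚ) / M.den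

/-- The spin of a multiplier as `Fin 2`. -/
def Mult.tau (M : Mult) : Fin 2 := if M.spin = 0 then 0 else 1

/-- Multiplier terms of the whole certificate in the sector `(a, b)`. -/
def multTerms (k : ℕ) [NeZero k] (a b : ℕ) (c : Cert) : Terms k :=
  c.mults.flatMap fun M => multTermsOf M.coeff (decWord k M.word) M.tau (if M.spin = 0 then a else b)

/-- ALL terms: `(H_F − E_core) − Gram − Mult`. -/
def certTerms [NeZero k] (F : Model k) (a b : ℕ) (c : Cert) : Terms k :=
  hamTerms F ++ negTerms (gramTerms k c) ++ negTerms (multTerms k a b c)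

/-- **The kernel bound**: `E_core + const − ℓ¹(rest)` of the collected normal form of `certTerms`. -/
def sosBound [NeZero k] (F : Model k) (a b : ℕ) (c : Cert) : ℚ :=
  F.ecore + lowerConst (normalize encL (2 * k + 2) (certTerms F a b c))



/-! ## Encoded polynomials (for block-wise replay: literals produced by `eval%`, re-checked by the kernel) -/

/-- A polynomial with letters coded `2·p + σ` and coefficients as (numerator, denominator). -/
abbrev EncPoly := List ((List ℕ × List ℕ) × (ℤ × ℕ))

/-- Encode (only ever used OUTSIDE the kernel, by `eval%`). -/
def encPoly (P : CARPoly.Poly (Orb (Fin k))) : EncPoly :=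
  P.map fun mq => ((mq.1.1.map encL, mq.1.2.map encL), (mq.2.num, mq.2.den))

/-- Decode a letter code `2·p + σ`. -/
def decOrb (k : ℕ) [NeZero k] (e : ℕ) : Orb (Fin k) := orb (Fin.ofNat k (e / 2)) (if e % 2 = 0 then 0 else 1)

/-- Decode an encoded polynomial. -/
def decPoly (k : ℕ) [NeZero k] (E : EncPoly) : CARPoly.Poly (Orb (Fin k)) :=
  E.map fun mc => ((mc.1.1.map (decOrb k), mc.1.2.map (decOrb k)), (mc.2.1 : ℚ) / mc.2.2)

/-- Instance-search shortcut (the nested search through the `Lex` order otherwise exceeds the synthesis budget). -/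
instance instDecidableEqTerm (k : ℕ) : DecidableEq (CARPoly.Mono (Orb (Fin k)) × ℚ) :=
  @instDecidableEqProd _ _ inferInstance inferInstance

/-- Instance-search shortcut: equality of polynomials over the orbitals of `k` spatial orbitals is decidable. -/
instance instDecidableEqPoly (k : ℕ) : DecidableEq (CARPoly.Poly (Orb (Fin k))) :=
  @instDecidableEqList _ (instDecidableEqTerm k)

end SOSDual

end Summit.Ventures.CertifiedQuantumChemistry
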